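import Literature.Barriers.QuantumAdvantage.TotalFunctionSpeedupLimit
import Literature.Computability.Complexity.CertificateAlgorithm
import Literature.Computability.QuantumComplexity.BlockSensitivityQuantumBound
import HarnessLib

/-!
# Proof of `TotalFunctionSpeedupLimit` (Beals et al. 2001, Theorem 5.4: `D(f) ≤ 4096 Q₂(f)⁶`)

Sibling proof file of `TotalFunctionSpeedupLimit.lean` (D-0014: the catalogue decl
`Literature.Barriers.QuantumAdvantage.TotalFunctionSpeedupLimit` and the fact
`bealsEtAl2001_thm54` stay `def`s; this file lands `TotalFunctionSpeedupLimit_holds` and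
`bealsEtAl2001_thm54_holds`, WITH the printed constant `4096`).

**The printed proof** (R. Beals, H. Buhrman, R. Cleve, M. Mosca, R. de Wolf, *Quantum lower
bounds by polynomials*, J. ACM 48 (2001), p. 11): "The previous two lemmas imply
`D(f) ≤ bs(f)³`. Combining this with Theorem 4.13 (`bs(f) ≤ 16 Q₂(f)²`), we obtain the main
result: **Theorem 5.4.** If `f` is a Boolean function, then `D(f) ≤ 4096 Q₂(f)⁶`."

In the tree, both ingredients are proved:
* `D(f) ≤ bs(f)³` is
  `Literature.Computability.Complexity.detQueryComplexity_le_blockSensitivity_pow_three`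
  (`CertificateAlgorithm.lean`: Lemma 5.3 `D(f) ≤ C⁽¹⁾(f) bs(f)` by algorithm **A**, with
  Nisan's Lemma 5.2 `C⁽¹⁾(f) ≤ C(f) ≤ bs(f)²` from `BlockSensitivity.lean`);
* `bs(f) ≤ 16 Q₂(f)²` is
  `Literature.Computability.QuantumComplexity.blockSensitivity_le_sixteen_mul_sq`
  (`BlockSensitivityQuantumBound.lean`: Theorem 4.13 through the polynomial method
  `PolynomialMethod.lean` (Lemmas 4.1/4.2), attainment of `Q₂` (`ExactQuantumQuery.lean`), the
  block substitution, Minsky–Papert symmetrization `Symmetrization.lean` (Lemma 3.2), and the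
  Ehlich–Zeller/Rivlin–Cheney degree bound `Literature/Analysis/Approximation/EhlichZeller.lean`
  (Theorem 4.12) resting on the sharp Markov inequality `MarkovInequality.lean` and Schur's
  lemma `SchurInequality.lean`).
Hence `D(f) ≤ (16 Q₂(f)²)³ = 4096 Q₂(f)⁶` for every `N` and every total `f : {0,1}^N → {0,1}`
(`detQueryComplexity_le_4096_mul_pow_six`), which is `bealsEtAl2001_thm54` (cast to `ℝ`) and,
definitionally, `TotalFunctionSpeedupLimit`; the catalogue's no-go reading
`¬ TotalSpeedupBeyond 6` becomes unconditional (`not_totalSpeedupBeyond_six`). (The tree's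
`∃ C` form quantum-advantage.S12, `detQueryComplexity_le_pow_six`, is already discharged in
`QueryComplexityProofs.lean`; `bealsEtAl2001_thm54_holds.detQueryComplexity_le_pow_six` gives it
again with `C = 4096`.)

## References

* R. Beals, H. Buhrman, R. Cleve, M. Mosca, R. de Wolf, *Quantum lower bounds by polynomials*,
  J. ACM 48 (2001) 778–797, Thm. 5.4 (arXiv:quant-ph/9802049, p. 11) [BealsEtAl2001].
-/

namespace Literature.Barriers.QuantumAdvantage

open Literature.Computability.Complexity Literature.Computability.Cryptography
  Literature.Computability.QuantumComplexity

/-- **Beals–Buhrman–Cleve–Mosca–de Wolf 2001, Theorem 5.4**, natural-number form: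
`D(f) ≤ 4096 Q₂(f)⁶` for every total Boolean function `f` on `N` bits
(`D(f) ≤ bs(f)³ ≤ (16 Q₂(f)²)³`). [cite: BealsEtAl2001, Thm 5.4] -/
theorem detQueryComplexity_le_4096_mul_pow_six {N : ℕ} (f : (Fin N → Bool) → Bool) :
    detQueryComplexity f ≤ 4096 * quantumQueryComplexity (1 / 3) f ^ 6 := by
  calc detQueryComplexity f ≤ blockSensitivity f ^ 3 :=
        detQueryComplexity_le_blockSensitivity_pow_three f
    _ ≤ (16 * quantumQueryComplexity (1 / 3) f ^ 2) ^ 3 :=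
        Nat.pow_le_pow_left (blockSensitivity_le_sixteen_mul_sq f) 3
    _ = 4096 * quantumQueryComplexity (1 / 3) f ^ 6 := by ring

/-- **Discharge of the named fact `bealsEtAl2001_thm54`** ("If `f` is a Boolean function, then
`D(f) ≤ 4096 Q₂(f)⁶`"), with the printed constant. [cite: BealsEtAl2001, Thm 5.4] -/
theorem bealsEtAl2001_thm54_holds : bealsEtAl2001_thm54 := by
  intro N f
  exact_mod_cast detQueryComplexity_le_4096_mul_pow_six f

/-- **Discharge of the barrier `TotalFunctionSpeedupLimit`** (definitionally Beals et al.'s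
Theorem 5.4). [cite: BealsEtAl2001, Thm 5.4] -/
theorem TotalFunctionSpeedupLimit_holds : TotalFunctionSpeedupLimit :=
  bealsEtAl2001_thm54_holds

/-- Unconditional form of the catalogue's no-go reading: no black-box quantum speedup beyond the
sixth power on total functions. [cite: BealsEtAl2001, Thm 5.4 and §1] -/
theorem not_totalSpeedupBeyond_six : ¬ TotalSpeedupBeyond 6 :=
  TotalFunctionSpeedupLimit_holds.not_totalSpeedupBeyond_six

/-- Unconditional randomized form: `R(f) ≤ 4096 Q₂(f)⁶` for every total `f`.
[cite: BealsEtAl2001, Thm 5.4 with §3 (Q₂ ≤ Q₀ ≤ Q_E ≤ D)] -/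
theorem randQueryComplexity_le_4096_mul_pow_six {N : ℕ} (f : (Fin N → Bool) → Bool) :
    (randQueryComplexity (1 / 3) f : ℝ) ≤ 4096 * (quantumQueryComplexity (1 / 3) f : ℝ) ^ 6 :=
  randQueryComplexity_le_of_thm54 TotalFunctionSpeedupLimit_holds N f

end Literature.Barriers.QuantumAdvantage
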